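import Summits.CriticalPhenomena.PercolationContinuityZ3.Theorems.PercExchangeRateTransportCriticalCurveRegular
import Summits.CriticalPhenomena.PercolationContinuityZ3.Theorems.PercExchangeRateTransportModelFacts

/-!
# fwd-rung G1 `next-rung`, generation 10, over `CriticalCurveRegular` — census candidate `IsoRightMin`
# (crux K⁺ `SupercritExchangeUniformity`, item stmt-CriticalPhenomena-16061; route `PercExchangeRateTransport`)

Seed / floor (item 16065, PROVED): `Cruxes.CriticalCurveRegular.Locmod.CriticalCurveRegular_proof : CriticalCurveRegular`
(continuity of the anisotropic critical curve `t ↦ p_c(t)` on `(0,1)` and `0 < p_c < 1`, label-coupled bond family on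
`ℤ²×ℤ`: x/y-bonds open iff `U_e ≤ p`, z-bonds iff `U_e ≤ t`).

CANDIDATE RUNG `IsoRightMin` (the mirror image of generation 7's `IsoLeftMin`, `Lines/iso_left_min.lean`): with
`J(t) := θ(p_c(t), t)` the critical density ON the curve and `p₃ := p_c(ℤ³)` the isotropic level, `p₃` is a RIGHT local
minimum of `J` along the curve: `∃ hi ∈ (p₃,1), ∀ s ∈ [p₃,hi], J(p₃) ≤ J(s)` — "adding a few vertical bonds at
criticality (and removing horizontal ones so as to stay critical) does not LOWER the percolation density".
Graded family `CurveRightMinWithin T` := floor ∧ (right-local-minimum clause at every level `t₀ ∈ T ∩ (0,1)`), antitone in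
`T`; `T = ∅` IS the floor (`curveRightMinWithin_empty_iff`), `T = {p₃}` is the rung.

ON THE S-PATH (proved below, no `sorry`): `PercolationContinuityZ3` (`θ_{ℤ³}(p_c) = 0`) gives
`J(p₃) = θ(p_c(p₃), p₃) ≤ θ(p₃,p₃) = 0 ≤ J(s)` exactly as for generation 7 (continuity of `p_c` at `p₃` — the floor —
and `p_c(t) ≤ t` above `p₃` give `p_c(p₃) ≤ p₃`; the diagonal is isotropic `ℤ³`, `ModelFacts` (9)).

VERDICT OF THIS SEAT: typed, kernel-checked, and REJECTED at C0 as a variant-by-reflection of the registered line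
`iso_left_min` (see `FWD-RUNG-G10.md`): same family shape, same on-path proof, same K⁺-on-one-arc fence stub; its only
distinct stub would be the UPPER sub-curve half of K⁻ on one arc (`Lines/onesided.lean` `stub_upperSubcurveBound`,
the half that needs the cutoff guard `δ < inf p_c`, K⁻ `Disproof.lean` §1), and — unlike the left order, which feeds
`S` through the planar anchor `t ↓ 0` (`SubcritExchangeUniformityClosesMono`) — the right order has no anchor toward `S`.
-/

namespace Summit.CriticalPhenomena.PercolationContinuityZ3.Cruxes.SupercritExchangeUniformity.RightMin

open Summit.CriticalPhenomena.PercolationContinuityZ3.Theses.PercExchangeRateTransport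

/-- FAMILY. The route's verbatim `let`-objects `μ, vert, cfg, θ, pc`; the floor `CriticalCurveRegular` AND, at every
level `t₀ ∈ T ∩ (0,1)`, the right-local-minimum clause: `∃ hi ∈ (t₀,1)`, `J(t₀) ≤ J(s)` for all `s ∈ [t₀,hi]`
(`J(t) = θ (pc t) t`). -/
def CurveRightMinWithin (T : Set ℝ) : Prop :=
  let μ := Literature.Probability.Percolation.labelMeasure (Literature.Probability.LatticeModels.Site 3); let vert : Sym2 (Literature.Probability.LatticeModels.Site 3) → Prop := fun e => ∃ x : Literature.Probability.LatticeModels.Site 3, e = s(x, x + Pi.single (2 : Fin 3) 1); let cfg : ℝ → ℝ → (Sym2 (Literature.Probability.LatticeModels.Site 3) → ℝ) → Set (Sym2 (Literature.Probability.LatticeModels.Site 3)) := fun p t U => {e | e ∈ (Literature.Probability.LatticeModels.zdGraph 3).edgeSet ∧ ((vert e ∧ U e ≤ t) ∨ (¬ vert e ∧ U e ≤ p))}; let θ : ℝ → ℝ → ℝ := fun p t => μ.real {U | cfg p t U ∈ Literature.Probability.Percolation.percolatesAt (0 : Literature.Probability.LatticeModels.Site 3)}; let pc : ℝ → ℝ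 := fun t => sInf ({p : ℝ | 0 ≤ p ∧ p ≤ 1 ∧ 0 < θ p t} ∪ {1}); (ContinuousOn pc (Set.Ioo 0 1) ∧ ∀ t ∈ Set.Ioo (0 : ℝ) 1, 0 < pc t ∧ pc t < 1) ∧ ∀ t₀ ∈ T, t₀ ∈ Set.Ioo (0 : ℝ) 1 → ∃ hi : ℝ, t₀ < hi ∧ hi < 1 ∧ ∀ s ∈ Set.Icc t₀ hi, θ (pc t₀) t₀ ≤ θ (pc s) s

/-- RUNG. The isotropic level `p₃ = p_c(ℤ³)` is a right local minimum of the critical density along the curve: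
the family at `T = {p₃}`. -/
def IsoRightMin : Prop := CurveRightMinWithin {Literature.Probability.Percolation.criticalProb (Literature.Probability.LatticeModels.zdGraph 3) (0 : Literature.Probability.LatticeModels.Site 3)}

/-- The family is antitone in the parameter `T`. -/
theorem curveRightMinWithin_mono {T T' : Set ℝ} (h : T ⊆ T') : CurveRightMinWithin T' → CurveRightMinWithin T := by
  unfold CurveRightMinWithin
  intro h'
  exact ⟨h'.1, fun t ht => h'.2 t (h ht)⟩

/-- WITNESS. The `T = ∅` member is the floor (proved from the seed). -/
theorem curveRightMinWithin_empty : CurveRightMinWithin ∅ := by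
  unfold CurveRightMinWithin
  exact ⟨Summit.CriticalPhenomena.PercolationContinuityZ3.Cruxes.CriticalCurveRegular.Locmod.CriticalCurveRegular_proof,
    fun t ht _ => (Set.notMem_empty t ht).elim⟩

/-- … and it is literally the floor (both directions). -/
theorem curveRightMinWithin_empty_iff : CurveRightMinWithin ∅ ↔ CriticalCurveRegular := by
  unfold CurveRightMinWithin CriticalCurveRegular
  exact ⟨fun h => h.1, fun h => ⟨h, fun t ht _ => (Set.notMem_empty t ht).elim⟩⟩

/-- The rung contains the floor. -/
@[aesop safe forward] theorem criticalCurveRegular_of_isoRightMin : IsoRightMin → CriticalCurveRegular := by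
  unfold IsoRightMin CurveRightMinWithin CriticalCurveRegular
  exact fun h => h.1

/-- Sanity: the rung hands back the `T = ∅` member. -/
theorem floor_of_rung : IsoRightMin → CurveRightMinWithin ∅ :=
  curveRightMinWithin_mono (Set.empty_subset _)

/-! ## The ON-PATH lemma (F4): `S → Rung` -/

/-- **ON-PATH LEMMA.** `PercolationContinuityZ3` implies the rung: the floor conjunct is the seed; by continuity
of `p_c` at `p₃` (the FLOOR) and `p_c(t) ≤ t` for `t > p₃` (`ModelFacts` (9): the diagonal is isotropic bond
percolation on `ℤ³`, `θ_{ℤ³} > 0` above `p_c(ℤ³)`), `p_c(p₃) ≤ p₃`; hence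
`J(p₃) = θ(p_c(p₃), p₃) ≤ θ(p₃,p₃) = θ_{ℤ³}(p_c(ℤ³)) = 0` under the statement, and `0 ≤ J(s)`; the right
end-point `hi := (p₃ + 1)/2`. -/
@[aesop safe forward] theorem isoRightMin_of_percolationContinuityZ3
    (hS : _root_.PercolationContinuityZ3) : IsoRightMin := by
  have hCC := Summit.CriticalPhenomena.PercolationContinuityZ3.Cruxes.CriticalCurveRegular.Locmod.CriticalCurveRegular_proof
  obtain ⟨-, -, -, -, -, -, -, -, h9, -⟩ :=
    Summit.CriticalPhenomena.PercolationContinuityZ3.Theorems.ModelFacts.modelFacts_proof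
  have h3b := Literature.Probability.Percolation.Grimmett1999_criticalProb_pos_lt_one_holds 3 (by norm_num)
  delta IsoRightMin CurveRightMinWithin
  intro μ vert cfg θ pc
  refine ⟨hCC, ?_⟩
  obtain ⟨hcc1, -⟩ := hCC
  intro t₀ ht₀ _
  rw [Set.mem_singleton_iff] at ht₀
  subst ht₀
  -- (a) above the isotropic level the curve lies on or left of the diagonal: `pc t ≤ t` for `p₃ < t < 1`
  have hle : ∀ t : ℝ, Literature.Probability.Percolation.criticalProb (Literature.Probability.LatticeModels.zdGraph 3) (0 : Literature.Probability.LatticeModels.Site 3) < t → t < 1 → pc t ≤ t := by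
    intro t h3t ht1
    have ht0 : 0 ≤ t := h3b.1.le.trans h3t.le
    have hpos : 0 < θ t t := by
      have e : θ t t = Literature.Probability.Percolation.theta (Literature.Probability.LatticeModels.zdGraph 3) 0 ⟨t, ht0, ht1.le⟩ :=
        h9 ⟨t, ht0, ht1.le⟩
      rw [e]
      exact Literature.Probability.Percolation.theta_pos_of_criticalProb_lt_holds _ _ _ h3t
    show sInf ({p : ℝ | 0 ≤ p ∧ p ≤ 1 ∧ 0 < θ p t} ∪ {1}) ≤ t
    refine csInf_le ⟨0, fun x hx => ?_⟩ (Set.mem_union_left _ ⟨ht0, ht1.le, hpos⟩)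
    rcases hx with hx | hx
    · exact hx.1
    · rw [Set.mem_singleton_iff] at hx
      rw [hx]
      norm_num
  -- (b) continuity of the curve at `p₃` (the floor): `pc p₃ ≤ p₃`
  have hca : ContinuousAt pc (Literature.Probability.Percolation.criticalProb (Literature.Probability.LatticeModels.zdGraph 3) (0 : Literature.Probability.LatticeModels.Site 3)) := hcc1.continuousAt (Ioo_mem_nhds h3b.1 h3b.2)
  have hev : ∀ᶠ t in nhdsWithin (Literature.Probability.Percolation.criticalProb (Literature.Probability.LatticeModels.zdGraph 3) (0 : Literature.Probability.LatticeModels.Site 3)) (Set.Ioi (Literature.Probability.Percolation.criticalProb (Literature.Probability.LatticeModels.zdGraph 3) (0 : Literature.Probability.LatticeModels.Site 3))), pc t ≤ id t :=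
    Filter.mem_of_superset (Ioo_mem_nhdsGT h3b.2) fun t ht => hle t ht.1 ht.2
  have hpc3 : pc (Literature.Probability.Percolation.criticalProb (Literature.Probability.LatticeModels.zdGraph 3) (0 : Literature.Probability.LatticeModels.Site 3)) ≤ Literature.Probability.Percolation.criticalProb (Literature.Probability.LatticeModels.zdGraph 3) (0 : Literature.Probability.LatticeModels.Site 3) :=
    le_of_tendsto_of_tendsto (hca.tendsto.mono_left nhdsWithin_le_nhds)
      ((continuous_id.tendsto _).mono_left nhdsWithin_le_nhds) hev
  -- (c) `J(p₃) ≤ θ(p₃,p₃) = θ_{ℤ³}(p_c) = 0 ≤ J(s)`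
  have hmono : θ (pc (Literature.Probability.Percolation.criticalProb (Literature.Probability.LatticeModels.zdGraph 3) (0 : Literature.Probability.LatticeModels.Site 3))) (Literature.Probability.Percolation.criticalProb (Literature.Probability.LatticeModels.zdGraph 3) (0 : Literature.Probability.LatticeModels.Site 3)) ≤ θ (Literature.Probability.Percolation.criticalProb (Literature.Probability.LatticeModels.zdGraph 3) (0 : Literature.Probability.LatticeModels.Site 3)) (Literature.Probability.Percolation.criticalProb (Literature.Probability.LatticeModels.zdGraph 3) (0 : Literature.Probability.LatticeModels.Site 3)) :=
    Summit.CriticalPhenomena.PercolationContinuityZ3.Cruxes.CriticalCurveRegular.Locmod.theta_mono hpc3 le_rfl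
  have hdiag : θ (Literature.Probability.Percolation.criticalProb (Literature.Probability.LatticeModels.zdGraph 3) (0 : Literature.Probability.LatticeModels.Site 3)) (Literature.Probability.Percolation.criticalProb (Literature.Probability.LatticeModels.zdGraph 3) (0 : Literature.Probability.LatticeModels.Site 3)) = 0 := by
    have e := h9 (Literature.Probability.Percolation.criticalProbI 3)
    exact e.trans hS
  refine ⟨(Literature.Probability.Percolation.criticalProb (Literature.Probability.LatticeModels.zdGraph 3) (0 : Literature.Probability.LatticeModels.Site 3) + 1) / 2, by linarith [h3b.2], by linarith [h3b.2], fun s _ => ?_⟩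
  have hnn : 0 ≤ θ (pc s) s := MeasureTheory.measureReal_nonneg
  exact (hmono.trans hdiag.le).trans hnn

/-- `S → Rung → floor`. -/
theorem rung_between :
    (_root_.PercolationContinuityZ3 → IsoRightMin) ∧ (IsoRightMin → CriticalCurveRegular) :=
  ⟨isoRightMin_of_percolationContinuityZ3, criticalCurveRegular_of_isoRightMin⟩

end Summit.CriticalPhenomena.PercolationContinuityZ3.Cruxes.SupercritExchangeUniformity.RightMin
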